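import Mathlib.AlgebraicGeometry.Morphisms.Etale
import Literature.AlgebraicGeometry.Hironaka2017.S15ARSchemes.R017YOfE
import HarnessLib

/-!
# [OURS · L1 W5.3] `CampaignW53DatumAfterHenselisation` — the local cotangent datum chosen AFTER HENSELISATION ONLY,
# with a uniform bound and a canonicity clause, replacing the ROLE of Rem. 15.4 (2)–(4) / Def. 15.5;
# NOT a statement of the manuscript

Cell `res-hironaka` (run/shared/lean/pub/res-hironaka/), LADDER-RESOLUTION rung L (rescue), RESCUE-SEED slot W5.3
«REPAIR THE LOCAL DATUM: replace "finite cotangent system generating Cot(Ě) on V_ξ" (Rem 15.4 (2)) by a constructible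
stratification + noetherian induction with generators chosen after henselisation only, glued by CANONICITY OF THE
CHOICE (p-flag Θ of §16.4) rather than by extension» (plan/RESCUE-SEED.md §1 L-G5/G6; L/SLOTS.md §2 W5.3). Typed by
the OURS typer o5 (statement-only lane) for res-L1-s53-plan-1 / res-L1-s53-pv-1 / kill test K5.3 (res-L1-k53).
Host (provisional, the slot's doors being «internal»; the slot planner may re-home): route MarkedTransfer, item
`HypersurfaceToMarked` (stmt-ResolutionOfSingularities-15522), whose recorded risk is exactly «no invariant to
synchronise the H_i of a presentation or to glue étale-local data» — the problem this campaign statement addresses.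

HONEST FRAMING. Every declaration below is OURS (a campaign statement of the cell) or folklore algebra; NOTHING here
is a statement of H. Hironaka's manuscript *Resolution of singularities in positive characteristics* (2017-03-23,
[Hironaka2017], lit key `paper:url-3343fd9e678b`) and nothing here asserts that any statement of it holds or fails.
The PRINTED item whose ROLE is replaced: Remark 15.4 p.76 L3–L14 (read on HOME/lit/layout/p0076.txt) — «(1) The
image of all h_jξ by the natural epimorohism [sic] from Cot(Ě) to 𝔳̄(E)_ξ is to generate the κ-vector space 𝔳̄(E)_ξ …
(2) The system {h_jξ} is finite and its members generate the ρ^ℓ(O)-module Cot(Ě)^m. (3) We can choose a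
sufficiently small affine open neighborhood V_ξ of ξ ∈ Z such that every {h_jξ} extends through V_ξ … at every
point η of V_ξ ∩ Sing(Ě)_cl. (4) A smooth irreducible closed subscheme Y_jξ is defined by h_jξ = (0) in V_ξ» — and
Definition 15.5 p.76 L20–L26 (the CotAR-scheme `𝔜(E)` built from the finite cover by the `V_ξ`); TYPED, not asserted,
as `Literature.AlgebraicGeometry.Hironaka2017.S15ARSchemes.Rem15_4*`, `Rem15_4Cover`, `yOfE` (row 017). The campaign
DROPS the Zariski neighbourhood `V_ξ` and the extension clause (3): the system `{h_j}` is chosen in the local ring of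
an ÉTALE neighbourhood of `ξ` with trivial residue extension (= after henselisation; Mathlib has no henselisation
functor for local rings, and `𝒪^h_{Z,ξ}` is the colimit of exactly these local rings — folklore, EGA IV 18.6), the
finiteness over `Sing(Ě)` is carried by a UNIFORM BOUND on the size of the system (the checkable content of
«constructible stratification + noetherian induction»; = the question of kill test K5.3 along the W-Q curve), and the
gluing is carried by an explicit CANONICITY PREDICATE, a parameter to be instantiated by the slot planner's reading
of «canonicity of the p-flag Θ(Ě, q(k)) of §16.4» (Def 16.15/16.16 p.88, typed `S16Proof.Def16_15/16_16`,
`thetaTop`, `sigmaThetaTop`) — NOT invented here. Barriers the slot must respect (RESCUE-SEED):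
`Literature.Barriers.ResolutionOfSingularities.NarasimhanMaximalContactNarrow_holds` (condition (4^h) below asks
for smooth hypersurface GERMS through ONE point after henselisation, not for a smooth hypersurface containing
`Sing ∩ V`), `InaccessibleIntermediateRing.not_isStrictlyAccessible`. AI review is weaker than expert review.

## What is defined (REAL definitions over existing tree/Mathlib vocabulary; parameters exactly as row 017)

Parameters (row 017's shapes, not re-declared): `A : AmbientDatum p K` (row 001), `ℓ : ℕ` («ℓ ≫ ℓ̄»), `cot η ⊆ 𝒪_{Z,η}`
(stalks of `Cot(Ě)`, row 015), `vbar ξ ⊆ 𝔪_ξ/𝔪_ξ²` (`𝔳̄(E)_ξ`, row 006), `Ec : IdealExponent A.Z` (the exponent of `Ě`).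
* `CampaignW53.HenselianDatum A ξ` — an étale `e : U ⟶ Z` (Mathlib `AlgebraicGeometry.Etale`), a point `u ↦ ξ` with
  `κ(ξ) → κ(u)` surjective (Nisnevich neighbourhood), and finitely many GERMS `h_j ∈ 𝒪_{U,u}`.
* `HenselianDatum.φ` (the local stalk map `𝒪_{Z,ξ} → 𝒪_{U,u}`), `.maximalIdeal_le_comap` (it is local — proved),
  `.cotangentMap` (`𝔪_ξ/𝔪_ξ² → 𝔪_u/𝔪_u²`, Mathlib `Ideal.mapCotangent`, ℤ-linear rendering).
* `CampaignW53.Cond1` = (1)^h: the classes of the `h_j` span the `κ(u)`-span of the image of `𝔳̄(E)_ξ`;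
  `CampaignW53.Cond2` = (2)^h (OURS reading of (2), exponent `m` dropped as in `Rem15_4_2_ours`): the
  `ρ^ℓ(𝒪_{U,u})`-span of the `h_j` equals that of the image of `Cot(Ě)_ξ` (row 001's `frobeniusPowerSubring`;
  characteristic-`p` structure of the stalk as a hypothesis binder, as in row 017);
  `CampaignW53.Cond4` = (4)^h: each `h_j ∈ 𝔪_u ∖ 𝔪_u²` (a regular parameter: `{h_j = 0}` is a smooth hypersurface GERM
  at `u`, `𝒪_{U,u}` being regular — the pointwise content of (4); irreducibility of a regular germ is automatic).
* `CampaignW53.DatumAt … ξ N IsCanonical` — ∃ such a datum at `ξ` with `≤ N` germs, (1)^h ∧ (2)^h ∧ (4)^h ∧ canonical.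
* `CampaignW53DatumAfterHenselisation IsCanonical` — the GLOBAL campaign statement: for all `p`, perfect `K`, `A`, `ℓ`,
  `Ec`, `cot`, `vbar`: ∃ a uniform `N` with `DatumAt … ξ N IsCanonical` at every closed `ξ ∈ Sing(Ě)`.

VACUITY SELF-CHECK (no side taken). (i) Not trivially true: (2)^h with finitely many germs forces the extended module
to be finitely generated over `ρ^ℓ(𝒪_{U,u})` and (1)^h/(4)^h force order-one generators — exactly what fails for smooth
contact along Narasimhan/W-Q shapes BEFORE henselisation is weakened only in the neighbourhood clause, not in the
order-one clause; the uniform `N` is a genuine constraint across `Sing(Ě)_cl`. (ii) Not trivially false: with `cot`,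
`vbar` the typed row-015/006 objects the identity neighbourhood is admissible (`U = Z`), so every Rem-15.4 datum in
the OURS reading yields a HenselianDatum satisfying (1)^h (2)^h (4)^h at `ξ` — the campaign statement is WEAKER than
`S15ARSchemes.Rem15_4_exists` pointwise and adds only `N` and `IsCanonical`. (iii) `IsCanonical := fun _ _ _ => True`
makes the canonicity clause void: the planner's instantiation is load-bearing and must be named in the item.

## References (orientation only)
* H. Hironaka, ms. 2017-03-23, §15.1 Rem 15.4 / Def 15.5 p.76 L3–L26; §16.4 Def 16.15/16.16 p.88 — printed roles under
  adjudication (GAP-LEDGER R18/R21, group 5), not cited as fact. [Hironaka2017]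
* EGA IV₄ §18.6 (henselisation as a filtered colimit of étale neighbourhoods) — folklore orientation for the proxy;
  no statement of it is used. Cell files: plan/RESCUE-SEED.md (W5.3), L/SLOTS.md §2 W5.3, ledger/group-5/DOSSIER.md
  §3 R18/R21, typer PREP L/res-L1-type-o5/PREP-W53-W54.md (OURS).
-/

noncomputable section

set_option linter.dupNamespace false -- mandated namespace of this single-conjunct summit

open _root_.CategoryTheory _root_.AlgebraicGeometry _root_.TopologicalSpace IsLocalRing
open Literature.AlgebraicGeometry.Resolution
open Literature.AlgebraicGeometry.Hironaka2017.S02Preliminaries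
open Literature.AlgebraicGeometry.Hironaka2017.S15ARSchemes

namespace Summit.ResolutionOfSingularities.ResolutionOfSingularities.Theorems

universe u

namespace CampaignW53

variable {p : ℕ} [Fact p.Prime] {K : Type u} [Field K] [CharP K p]
variable (A : AmbientDatum p K)

/-- OURS [L1 W5.3] (definition; replaces the raw datum `S15ARSchemes.Rem15_4Data` = «(V_ξ, {h_jξ})» p.75 L34 / p.76
L7–L10; NOT a statement of the manuscript). **A cotangent system chosen after henselisation at `ξ`**: an étale
neighbourhood `e : U → Z` of `ξ` with a point `u ↦ ξ` whose residue field extension `κ(ξ) → κ(u)` is trivial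
(surjective), together with finitely many GERMS `h_j ∈ 𝒪_{U,u}`. No open `V_ξ`, no sections, no extension clause.
[folklore] -/
structure HenselianDatum (ξ : A.Z) where
  /-- the étale neighbourhood (total space) -/
  U : Scheme.{u}
  /-- its structure map to `Z` -/
  e : U ⟶ A.Z
  /-- `e` is étale (Mathlib `AlgebraicGeometry.Etale`) -/
  etale : Etale e
  /-- the point of `U` over `ξ` -/
  u : U
  /-- `u ↦ ξ` -/
  base_u : e.base u = ξ
  /-- trivial residue field extension: `κ(ξ) → κ(u)` is onto -/
  residue_surj : Function.Surjective (e.residueFieldMap u)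
  /-- the index set of the system `{h_j}` -/
  ι : Type u
  /-- «the system is finite» -/
  finite_ι : Finite ι
  /-- the germs `h_j ∈ 𝒪_{U,u}` -/
  h : ι → U.presheaf.stalk u

variable {A}

/-- The local homomorphism `φ : 𝒪_{Z,ξ} → 𝒪_{U,u}` of the datum (`ξ` in the form `e u`). [folklore] -/
def HenselianDatum.φ {ξ : A.Z} (D : HenselianDatum A ξ) :
    A.Z.presheaf.stalk (D.e.base D.u) →+* D.U.presheaf.stalk D.u :=
  (D.e.stalkMap D.u).hom

/-- `φ` is local: `𝔪_ξ ≤ φ⁻¹(𝔪_u)`. [folklore] -/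
theorem HenselianDatum.maximalIdeal_le_comap {ξ : A.Z} (D : HenselianDatum A ξ) :
    maximalIdeal (A.Z.presheaf.stalk (D.e.base D.u)) ≤ (maximalIdeal (D.U.presheaf.stalk D.u)).comap D.φ := by
  haveI : IsLocalHom D.φ := inferInstanceAs (IsLocalHom (D.e.stalkMap D.u).hom)
  intro x hx
  rw [Ideal.mem_comap, IsLocalRing.mem_maximalIdeal] at *
  exact (map_mem_nonunits_iff D.φ x).mpr hx

/-- The induced map on cotangent spaces `𝔪_ξ/𝔪_ξ² → 𝔪_u/𝔪_u²` (Mathlib `Ideal.mapCotangent`, as a `ℤ`-linear map;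
it is `κ(ξ) → κ(u)`-semilinear). [folklore] -/
def HenselianDatum.cotangentMap {ξ : A.Z} (D : HenselianDatum A ξ) :
    CotangentSpace (A.Z.presheaf.stalk (D.e.base D.u)) →ₗ[ℤ] CotangentSpace (D.U.presheaf.stalk D.u) :=
  Ideal.mapCotangent (maximalIdeal (A.Z.presheaf.stalk (D.e.base D.u)))
    (maximalIdeal (D.U.presheaf.stalk D.u)) D.φ.toIntAlgHom D.maximalIdeal_le_comap

variable (ℓ : ℕ) (cot : ∀ η : A.Z, Set (A.Z.presheaf.stalk η))
  (vbar : ∀ ξ : A.Z, Submodule (ResidueField (A.Z.presheaf.stalk ξ)) (CotangentSpace (A.Z.presheaf.stalk ξ)))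

/-- OURS [L1 W5.3] **(1)^h** — replaces the role of Rem 15.4 (1) p.76 L5–L6 at the point, after henselisation; NOT a
statement of the manuscript: the germs `h_j` lie in `𝔪_u` and their classes in `𝔪_u/𝔪_u²` span the `κ(u)`-span of
the image of `𝔳̄(E)_ξ` (parameter `vbar`, row 006) under the cotangent map. [folklore] -/
def Cond1 {ξ : A.Z} (D : HenselianDatum A ξ) : Prop :=
  ∃ hm : ∀ j, D.h j ∈ maximalIdeal (D.U.presheaf.stalk D.u),
    Submodule.span (ResidueField (D.U.presheaf.stalk D.u))
        (Set.range fun j => (maximalIdeal (D.U.presheaf.stalk D.u)).toCotangent ⟨D.h j, hm j⟩) =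
      Submodule.span (ResidueField (D.U.presheaf.stalk D.u))
        (D.cotangentMap '' (vbar (D.e.base D.u) : Set (CotangentSpace (A.Z.presheaf.stalk (D.e.base D.u)))))

/-- OURS [L1 W5.3] **(2)^h** — replaces the role of Rem 15.4 (2) p.76 L7–L8 (OURS reading without the exponent `m`,
cf. `S15ARSchemes.Rem15_4_2_ours`) at the point, after henselisation; NOT a statement of the manuscript: as
`ρ^ℓ(𝒪_{U,u})`-modules (row 001's `frobeniusPowerSubring`), the span of the `h_j` equals the span of the image of the
stalk `Cot(Ě)_ξ` (parameter `cot`, row 015). The characteristic-`p` structure of `𝒪_{U,u}` is a hypothesis binder.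
[folklore] -/
def Cond2 {ξ : A.Z} (D : HenselianDatum A ξ) : Prop :=
  ∀ _ : CharP (D.U.presheaf.stalk D.u) p,
    Submodule.span (frobeniusPowerSubring (D.U.presheaf.stalk D.u) p ℓ) (Set.range D.h) =
      Submodule.span (frobeniusPowerSubring (D.U.presheaf.stalk D.u) p ℓ) (D.φ '' cot (D.e.base D.u))

/-- OURS [L1 W5.3] **(4)^h** — replaces the role of Rem 15.4 (4) p.76 L13–L14 («a smooth irreducible closed subscheme
Y_jξ is defined by h_jξ = (0) in V_ξ») at the point, after henselisation; NOT a statement of the manuscript: every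
`h_j` is a REGULAR PARAMETER of `𝒪_{U,u}` (`h_j ∈ 𝔪_u`, `h_j ∉ 𝔪_u²`), i.e. `{h_j = 0}` is a smooth hypersurface germ
at `u` (for the regular local ring `𝒪_{U,u}` — `U` étale over the smooth `Z` — the two are equivalent; the germ of a
regular local scheme is irreducible). [folklore] -/
def Cond4 {ξ : A.Z} (D : HenselianDatum A ξ) : Prop :=
  ∀ j, D.h j ∈ maximalIdeal (D.U.presheaf.stalk D.u) ∧ D.h j ∉ maximalIdeal (D.U.presheaf.stalk D.u) ^ 2

/-- OURS [L1 W5.3] — the LOCAL campaign predicate at one closed point `ξ` (what res-L1-s53-pv-1 instantiates along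
the W-Q curve first; NOT a statement of the manuscript): a cotangent system after henselisation at `ξ` with at most
`N` members satisfying (1)^h, (2)^h, (4)^h and the canonicity predicate `IsCanonical` (the slot planner's reading of
«canonicity of the p-flag Θ of §16.4» — an explicit parameter, not fixed here). [folklore] -/
def DatumAt (IsCanonical : ∀ ξ : A.Z, HenselianDatum A ξ → Prop) (ξ : A.Z) (N : ℕ) : Prop :=
  ∃ D : HenselianDatum A ξ, Nat.card D.ι ≤ N ∧ Cond1 vbar D ∧ Cond2 ℓ cot D ∧ Cond4 D ∧ IsCanonical ξ D

end CampaignW53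

/-- **DEPRECATED (v3, 2026-08-26; lane A res-L1-ref-a2 19:21:11Z BOUNCED-OURS, confirmed by the typer): this v1 form
quantifies `cot`, `vbar` universally INSIDE the statement and is FALSE by the junk witness `cot := fun _ => Set.univ` (Cond1
puts the `h_j` in `𝔪_u`, Cond2 then asks `1 ∈ span ⊆ 𝔪_u`); kept byte-identical under the append-only rule, superseded by the
PARAMETRIC predicate `CampaignW53DatumAfterHenselisationOf` below (use that).**
**[OURS · L1 W5.3] `CampaignW53DatumAfterHenselisation` — replaces the role of Rem. 15.4 (2)–(4) p.76 L7–L14 and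
of the finite cover of Def. 15.5 p.76 L15–L26 (typed `S15ARSchemes.Rem15_4_exists`, `U76L16`, `Rem15_4Cover`,
`yOfE`) in the architecture (consumers: Th 10.4 R07, Th 16.6 (1)); NOT a statement of the manuscript.** For every
prime `p`, PERFECT field `K` of characteristic `p` (§2 convention as a hypothesis), ambient datum `A` (row 001),
`ℓ : ℕ`, ideal exponent `Ec` (the exponent of the core focus `Ě`, row 010 — no core-focus predicate is consumed here),
stalk family `cot` (row 015) and cotangent family `vbar` (row 006): there is a UNIFORM bound `N` such that at every
CLOSED point `ξ ∈ Sing(Ě)` a cotangent system chosen after henselisation exists with `≤ N` members, (1)^h, (2)^h,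
(4)^h, and canonical in the sense of the parameter `IsCanonical`. Hypotheses are typed carriers only; no Hironaka2017
claim and no FACT-LIST row is a premise. Vacuity: see the module docstring ((iii): the trivial `IsCanonical` voids the
gluing clause — the planner's instantiation is load-bearing). [folklore] -/
def CampaignW53DatumAfterHenselisation
    (IsCanonical : ∀ {p : ℕ} [Fact p.Prime] {K : Type u} [Field K] [CharP K p] (A : AmbientDatum p K)
      (ℓ : ℕ) (Ec : IdealExponent A.Z) (ξ : A.Z), CampaignW53.HenselianDatum A ξ → Prop) : Prop :=
  ∀ (p : ℕ) [Fact p.Prime] (K : Type u) [Field K] [CharP K p] [PerfectField K]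
    (A : AmbientDatum p K) (ℓ : ℕ) (Ec : IdealExponent A.Z)
    (cot : ∀ η : A.Z, Set (A.Z.presheaf.stalk η))
    (vbar : ∀ ξ : A.Z, Submodule (ResidueField (A.Z.presheaf.stalk ξ)) (CotangentSpace (A.Z.presheaf.stalk ξ))),
    ∃ N : ℕ, ∀ ξ ∈ Ec.sing ∩ Literature.AlgebraicGeometry.Hironaka2017.S02Preliminaries.closedPoints A.Z,
      CampaignW53.DatumAt ℓ cot vbar (IsCanonical A ℓ Ec) ξ N

/-! ## Appended 2026-08-26 (supersede #1, append-only): the ENCLOSURE clause (119) after henselisation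

Alignment with kill test K5.3 as PRE-REGISTERED (res-L1-k53, HOME/STATUS 19:03:54Z, L/res-L1-k53/PREREG-K5.3.md): its
object «pointwise formal datum of size N at η» carries, besides (D1) = (1)^h and (D4) = (4)^h, the clause
(D119) «h_j ∈ I(Sing(E)_red)·Ô» — the germ form of Eq.(119) p.77 L11–L12 «for η ∈ Z_cl ∩ V_j we have
ord_η(Cot(Ě)) ≥ 1 ⟺ η ∈ ∩_i Y_ji» read with Th 14.6 p.70 («Cot ⊆ I(Sing(Ě))») and Def 15.1 (1): the hypersurface
germs `Y_j = {h_j = 0}` CONTAIN the singular locus. The decls above are unchanged (byte-identical); the decls below add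
the clause as `Cond119` and the enclosure variants `DatumEncAt` / `CampaignW53DatumAfterHenselisationEnc`, with the
pure-logic anchor `datumAt_of_datumEncAt`. K5.3 also registers Rem 15.4 (2)'s bare `ρ^ℓ(O)`-finiteness as automatic
(`𝒪` is finite over `ρ^ℓ(𝒪)`); `Cond2` above asks MORE (the SAME order-one germs generate `Cot(Ě)_ξ·𝒪_{U,u}`), so it
is kept. Which variant the campaign item names is res-L1-s53-plan-1's call. NOT a statement of the manuscript. -/

namespace CampaignW53

variable {p : ℕ} [Fact p.Prime] {K : Type u} [Field K] [CharP K p] {A : AmbientDatum p K}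
variable (ℓ : ℕ) (Ec : IdealExponent A.Z) (cot : ∀ η : A.Z, Set (A.Z.presheaf.stalk η))
  (vbar : ∀ ξ : A.Z, Submodule (ResidueField (A.Z.presheaf.stalk ξ)) (CotangentSpace (A.Z.presheaf.stalk ξ)))

/-- OURS [L1 W5.3] (definition). The ideal `I(Sing(Ě)_red)_ξ · 𝒪_{U,u}` of the datum: the stalk at `ξ = e u` of the
vanishing (radical) ideal sheaf of the closure of `Sing(Ě)` (Mathlib `Scheme.IdealSheafData.vanishingIdeal`; tree
`Resolution.stalkIdeal`), extended along the local stalk map `φ : 𝒪_{Z,ξ} → 𝒪_{U,u}` (`Ideal.map`). The closure equals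
`Sing(Ě)` whenever the latter is closed; taking it keeps the definition proof-free. [folklore] -/
def HenselianDatum.singIdeal {ξ : A.Z} (D : HenselianDatum A ξ) : Ideal (D.U.presheaf.stalk D.u) :=
  (stalkIdeal (_root_.AlgebraicGeometry.Scheme.IdealSheafData.vanishingIdeal
      (⟨closure Ec.sing, isClosed_closure⟩ : TopologicalSpace.Closeds A.Z)) (D.e.base D.u)).map D.φ

/-- OURS [L1 W5.3] **(119)^h** — replaces the role of Eq.(119) p.77 L11–L12 («ord_η(Cot(Ě)) ≥ 1 ⟺ η ∈ ∩_i Y_ji», read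
with Th 14.6 p.70 and Def 15.1 (1): the `Y_ji` contain the singular locus) at the point, after henselisation; NOT a
statement of the manuscript: every germ `h_j` lies in `I(Sing(Ě)_red)_ξ · 𝒪_{U,u}`, i.e. the hypersurface germ
`{h_j = 0}` contains the germ of `Sing(Ě)_red` pulled back to the étale neighbourhood (= K5.3's clause (D119), stated
there in the completion). [folklore] -/
def Cond119 {ξ : A.Z} (D : HenselianDatum A ξ) : Prop :=
  ∀ j, D.h j ∈ D.singIdeal Ec

/-- OURS [L1 W5.3] — the LOCAL campaign predicate WITH ENCLOSURE at one closed point `ξ` (NOT a statement of the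
manuscript): a cotangent system after henselisation at `ξ` with at most `N` members satisfying (1)^h, (2)^h, (4)^h,
(119)^h and `IsCanonical`. This is the object kill test K5.3 pre-registered («pointwise formal datum of size N»,
(D1)+(D4)+(D119), N ≤ n), up to its use of the completion in place of an étale neighbourhood. [folklore] -/
def DatumEncAt (IsCanonical : ∀ ξ : A.Z, HenselianDatum A ξ → Prop) (ξ : A.Z) (N : ℕ) : Prop :=
  ∃ D : HenselianDatum A ξ, Nat.card D.ι ≤ N ∧ Cond1 vbar D ∧ Cond2 ℓ cot D ∧ Cond4 D ∧ Cond119 Ec D ∧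
    IsCanonical ξ D

/-- Enclosure variant ⇒ plain variant (drop (119)^h) — pure logic, recorded for the lanes. [folklore] -/
theorem datumAt_of_datumEncAt {IsCanonical : ∀ ξ : A.Z, HenselianDatum A ξ → Prop} {ξ : A.Z} {N : ℕ}
    (h : DatumEncAt ℓ Ec cot vbar IsCanonical ξ N) : DatumAt ℓ cot vbar IsCanonical ξ N := by
  obtain ⟨D, hN, h1, h2, h4, -, hc⟩ := h
  exact ⟨D, hN, h1, h2, h4, hc⟩

end CampaignW53

/-- **DEPRECATED (v3, 2026-08-26): same defect as `CampaignW53DatumAfterHenselisation` (free `cot`/`vbar` binders, false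
by the junk witness); kept byte-identical, superseded by `CampaignW53DatumAfterHenselisationEncOf` below (use that).**
**[OURS · L1 W5.3] `CampaignW53DatumAfterHenselisationEnc` — the slot statement WITH THE ENCLOSURE CLAUSE (119)^h**
(replaces the role of Rem. 15.4 (2)–(4) p.76 L7–L14, of the finite cover of Def. 15.5 p.76 L15–L26 AND of Eq.(119)
p.77 L11–L12 / Def 15.1 (1) «Y_ji ⊇ Sing»; NOT a statement of the manuscript): as `CampaignW53DatumAfterHenselisation`
with `DatumEncAt` in place of `DatumAt`. This is the variant whose pointwise instances kill test K5.3 scores along the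
W-Q curve (ALIVE ⇒ hand-over «with N₀ = n»; DEAD at a point ⇒ this variant fails there for every `N`). Vacuity: as in
the module docstring; (119)^h is a genuine extra constraint (it fails for a regular parameter transverse to `Sing`).
[folklore] -/
def CampaignW53DatumAfterHenselisationEnc
    (IsCanonical : ∀ {p : ℕ} [Fact p.Prime] {K : Type u} [Field K] [CharP K p] (A : AmbientDatum p K)
      (ℓ : ℕ) (Ec : IdealExponent A.Z) (ξ : A.Z), CampaignW53.HenselianDatum A ξ → Prop) : Prop :=
  ∀ (p : ℕ) [Fact p.Prime] (K : Type u) [Field K] [CharP K p] [PerfectField K]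
    (A : AmbientDatum p K) (ℓ : ℕ) (Ec : IdealExponent A.Z)
    (cot : ∀ η : A.Z, Set (A.Z.presheaf.stalk η))
    (vbar : ∀ ξ : A.Z, Submodule (ResidueField (A.Z.presheaf.stalk ξ)) (CotangentSpace (A.Z.presheaf.stalk ξ))),
    ∃ N : ℕ, ∀ ξ ∈ Ec.sing ∩ Literature.AlgebraicGeometry.Hironaka2017.S02Preliminaries.closedPoints A.Z,
      CampaignW53.DatumEncAt ℓ Ec cot vbar (IsCanonical A ℓ Ec) ξ N

/-- DEPRECATED (v3): relates the two deprecated v1/v2 statements; superseded by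
`campaignW53DatumAfterHenselisationOf_of_enc`. Enclosure variant ⇒ plain variant of the slot statement — pure logic.
[folklore] -/
theorem campaignW53DatumAfterHenselisation_of_enc
    {IsCanonical : ∀ {p : ℕ} [Fact p.Prime] {K : Type u} [Field K] [CharP K p] (A : AmbientDatum p K)
      (ℓ : ℕ) (Ec : IdealExponent A.Z) (ξ : A.Z), CampaignW53.HenselianDatum A ξ → Prop}
    (h : CampaignW53DatumAfterHenselisationEnc IsCanonical) : CampaignW53DatumAfterHenselisation IsCanonical := by
  intro p _ K _ _ _ A ℓ Ec cot vbar
  obtain ⟨N, hN⟩ := h p K A ℓ Ec cot vbar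
  exact ⟨N, fun ξ hξ => CampaignW53.datumAt_of_datumEncAt ℓ Ec cot vbar (hN ξ hξ)⟩

/-! ## Appended 2026-08-26 (supersede #2, v3): PARAMETRIC slot statements (repair of the lane-A bounce)

Lane A (res-L1-ref-a2, HOME/STATUS 19:21:11Z) BOUNCED the v1 top-level statement: `cot`/`vbar` were universally
quantified INSIDE it, so the junk family `cot := fun _ => Set.univ` falsifies it at every closed singular point — a
typing artefact (F2), not a finding about the slot. The intended reading is a PREDICATE ON the row-015/006 objects,
exactly as row 017's `S15ARSchemes.Rem15_4_exists A ℓ Ec cot vbar`; the campaign item instantiates `cot`, `vbar` with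
the typed `Cot(Ě)` stalks (row 015 `S13GLUEDDiagram.Cot`, ring level) and `𝔳̄(E)` (row 006 `S04CharAlgebra.cotVec*`).
The gate's append-only rule keeps the v1/v2 decls byte-identical; they are marked `deprecated` at the end of this file
(after their last use) in favour of the decls below. NOT a statement of the manuscript. -/

/-- **[OURS · L1 W5.3] `CampaignW53DatumAfterHenselisationOf A ℓ Ec cot vbar IsCanonical` — THE SLOT STATEMENT (v3,
parametric), replacing the role of Rem. 15.4 (2)–(4) p.76 L7–L14 and of the finite cover of Def. 15.5 p.76 L15–L26
(typed `S15ARSchemes.Rem15_4_exists`, `U76L16`, `Rem15_4Cover`, `yOfE`); NOT a statement of the manuscript.** For ONE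
ambient datum `A` over a PERFECT field `K` of characteristic `p` (§2 convention as an instance hypothesis), `ℓ : ℕ`
(«ℓ ≫ ℓ̄»), the exponent `Ec` of the core focus `Ě` (row 010; no core-focus predicate consumed), the stalk family `cot`
of `Cot(Ě)` (row 015) and the cotangent family `vbar` = `𝔳̄(E)` (row 006) — PARAMETERS, to be instantiated with the typed
objects — and the planner's canonicity predicate `IsCanonical`: there is a UNIFORM bound `N` such that at every CLOSED
point `ξ ∈ Sing(Ě)` a cotangent system chosen after henselisation exists with `≤ N` members, (1)^h, (2)^h, (4)^h and
`IsCanonical` (`CampaignW53.DatumAt`). Vacuity: module docstring (i)–(iii); at junk `cot`/`vbar` the predicate can be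
false (lane A's witness) or easy — it is meant at the typed objects only, like every consumer of row 017. [folklore] -/
def CampaignW53DatumAfterHenselisationOf {p : ℕ} [Fact p.Prime] {K : Type u} [Field K] [CharP K p]
    [PerfectField K] (A : AmbientDatum p K) (ℓ : ℕ) (Ec : IdealExponent A.Z)
    (cot : ∀ η : A.Z, Set (A.Z.presheaf.stalk η))
    (vbar : ∀ ξ : A.Z, Submodule (ResidueField (A.Z.presheaf.stalk ξ)) (CotangentSpace (A.Z.presheaf.stalk ξ)))
    (IsCanonical : ∀ ξ : A.Z, CampaignW53.HenselianDatum A ξ → Prop) : Prop :=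
  ∃ N : ℕ, ∀ ξ ∈ Ec.sing ∩ Literature.AlgebraicGeometry.Hironaka2017.S02Preliminaries.closedPoints A.Z,
    CampaignW53.DatumAt ℓ cot vbar IsCanonical ξ N

/-- **[OURS · L1 W5.3] `CampaignW53DatumAfterHenselisationEncOf A ℓ Ec cot vbar IsCanonical` — the slot statement WITH THE
ENCLOSURE CLAUSE (119)^h (v3, parametric; replaces in addition the role of Eq.(119) p.77 L11–L12 / Def 15.1 (1)
«Y_ji ⊇ Sing»); NOT a statement of the manuscript.** As `CampaignW53DatumAfterHenselisationOf` with `CampaignW53.DatumEncAt`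
in place of `DatumAt`. This is the variant whose pointwise instances kill test K5.3 scores along the W-Q curve (ALIVE ⇒
hand-over «with N₀ = n»; DEAD at a point ⇒ it fails there for every `N`). [folklore] -/
def CampaignW53DatumAfterHenselisationEncOf {p : ℕ} [Fact p.Prime] {K : Type u} [Field K] [CharP K p]
    [PerfectField K] (A : AmbientDatum p K) (ℓ : ℕ) (Ec : IdealExponent A.Z)
    (cot : ∀ η : A.Z, Set (A.Z.presheaf.stalk η))
    (vbar : ∀ ξ : A.Z, Submodule (ResidueField (A.Z.presheaf.stalk ξ)) (CotangentSpace (A.Z.presheaf.stalk ξ)))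
    (IsCanonical : ∀ ξ : A.Z, CampaignW53.HenselianDatum A ξ → Prop) : Prop :=
  ∃ N : ℕ, ∀ ξ ∈ Ec.sing ∩ Literature.AlgebraicGeometry.Hironaka2017.S02Preliminaries.closedPoints A.Z,
    CampaignW53.DatumEncAt ℓ Ec cot vbar IsCanonical ξ N

/-- Enclosure variant ⇒ plain variant (v3, parametric) — pure logic. [folklore] -/
theorem campaignW53DatumAfterHenselisationOf_of_enc {p : ℕ} [Fact p.Prime] {K : Type u} [Field K]
    [CharP K p] [PerfectField K] {A : AmbientDatum p K} {ℓ : ℕ} {Ec : IdealExponent A.Z}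
    {cot : ∀ η : A.Z, Set (A.Z.presheaf.stalk η)}
    {vbar : ∀ ξ : A.Z, Submodule (ResidueField (A.Z.presheaf.stalk ξ)) (CotangentSpace (A.Z.presheaf.stalk ξ))}
    {IsCanonical : ∀ ξ : A.Z, CampaignW53.HenselianDatum A ξ → Prop}
    (h : CampaignW53DatumAfterHenselisationEncOf A ℓ Ec cot vbar IsCanonical) :
    CampaignW53DatumAfterHenselisationOf A ℓ Ec cot vbar IsCanonical := by
  obtain ⟨N, hN⟩ := h
  exact ⟨N, fun ξ hξ => CampaignW53.datumAt_of_datumEncAt ℓ Ec cot vbar (hN ξ hξ)⟩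

/-- The deprecated v1 statement is the universal closure of the v3 predicate over ALL families `cot`, `vbar` (which is
why it is false: it includes the junk families) — pure logic, `Iff.rfl` up to binder order. [folklore] -/
theorem campaignW53DatumAfterHenselisation_iff_forall_of
    (IsCanonical : ∀ {p : ℕ} [Fact p.Prime] {K : Type u} [Field K] [CharP K p] (A : AmbientDatum p K)
      (ℓ : ℕ) (Ec : IdealExponent A.Z) (ξ : A.Z), CampaignW53.HenselianDatum A ξ → Prop) :
    CampaignW53DatumAfterHenselisation IsCanonical ↔
      ∀ (p : ℕ) [Fact p.Prime] (K : Type u) [Field K] [CharP K p] [PerfectField K]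
        (A : AmbientDatum p K) (ℓ : ℕ) (Ec : IdealExponent A.Z)
        (cot : ∀ η : A.Z, Set (A.Z.presheaf.stalk η))
        (vbar : ∀ ξ : A.Z, Submodule (ResidueField (A.Z.presheaf.stalk ξ)) (CotangentSpace (A.Z.presheaf.stalk ξ))),
        CampaignW53DatumAfterHenselisationOf A ℓ Ec cot vbar (IsCanonical A ℓ Ec) :=
  Iff.rfl

attribute [deprecated CampaignW53DatumAfterHenselisationOf (since := "2026-08-26")]
  CampaignW53DatumAfterHenselisation
attribute [deprecated CampaignW53DatumAfterHenselisationEncOf (since := "2026-08-26")]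
  CampaignW53DatumAfterHenselisationEnc
attribute [deprecated campaignW53DatumAfterHenselisationOf_of_enc (since := "2026-08-26")]
  campaignW53DatumAfterHenselisation_of_enc

/-! ## Appended 2026-08-26 (supersede #3, append-only): the CONORMAL criterion side of kill test K5.3

K5.3 (res-L1-k53, PREREG 19:03:54Z, PREREG-K5.3.md l.14–15) scores the pointwise datum through «a pointwise formal datum
exists at η ⟺ v(E)_η ⊆ V_adm(η) := (I(Sing(E)_red)_η + 𝔪²)/𝔪²» (conormal space; `dim = n − edim_η Sing(E)_red`). Typed
below INTRINSICALLY on `Z` (the criterion is insensitive to henselisation) so the verdict bit at a point is a named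
predicate; its equivalence with `DatumEncAt` minus (2)^h and `IsCanonical` is k53's claim, certified in its own file,
not asserted here. NOT a statement of the manuscript. -/

namespace CampaignW53

variable {p : ℕ} [Fact p.Prime] {K : Type u} [Field K] [CharP K p] {A : AmbientDatum p K}

/-- OURS [L1 W5.3] (definition). **The conormal space `V_adm(ξ) ⊆ 𝔪_ξ/𝔪_ξ²` of the reduced singular locus at `ξ`**: the
`κ(ξ)`-span of the classes of the elements of `𝔪_ξ` lying in `I(Sing(Ě)_red)_ξ` (stalk of Mathlib
`Scheme.IdealSheafData.vanishingIdeal` of the closure of `Sing(Ě)`, tree `Resolution.stalkIdeal`), i.e.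
`(I(Sing(Ě)_red)_ξ + 𝔪_ξ²)/𝔪_ξ²` — K5.3's `V_adm(η)`. [folklore] -/
def conormalSpaceAt (Ec : IdealExponent A.Z) (ξ : A.Z) :
    Submodule (ResidueField (A.Z.presheaf.stalk ξ)) (CotangentSpace (A.Z.presheaf.stalk ξ)) :=
  Submodule.span (ResidueField (A.Z.presheaf.stalk ξ))
    ((maximalIdeal (A.Z.presheaf.stalk ξ)).toCotangent ''
      {x : maximalIdeal (A.Z.presheaf.stalk ξ) |
        (x : A.Z.presheaf.stalk ξ) ∈
          stalkIdeal (_root_.AlgebraicGeometry.Scheme.IdealSheafData.vanishingIdeal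
            (⟨closure Ec.sing, isClosed_closure⟩ : TopologicalSpace.Closeds A.Z)) ξ})

/-- **[OURS · L1 W5.3] `ConormalAdmissibleAt Ec vbar ξ` — K5.3's existence criterion as a predicate; NOT a statement of
the manuscript.** `𝔳̄(E)_ξ ⊆ V_adm(ξ)`: every cotangent class of the exponent at `ξ` (parameter `vbar`, row 006) lies in
the conormal space of `Sing(Ě)_red` at `ξ` — equivalently, kills the Zariski tangent space `T_ξ(Sing(Ě)_red)`. Per
K5.3 this is equivalent to the existence of a pointwise datum with (1)^h (4)^h (119)^h at `ξ` (then `N = dim 𝔳̄(E)_ξ ≤ n`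
germs suffice); it FAILS exactly when some cotangent class is not conormal, in particular whenever `𝔳̄(E)_ξ ≠ 0` and
`edim_ξ Sing(Ě)_red = n` (`V_adm(ξ) = 0`; the expected W-Q origin case). [folklore] -/
def ConormalAdmissibleAt (Ec : IdealExponent A.Z)
    (vbar : ∀ ξ : A.Z, Submodule (ResidueField (A.Z.presheaf.stalk ξ)) (CotangentSpace (A.Z.presheaf.stalk ξ)))
    (ξ : A.Z) : Prop :=
  vbar ξ ≤ conormalSpaceAt Ec ξ

end CampaignW53

end Summit.ResolutionOfSingularities.ResolutionOfSingularities.Theorems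

end
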